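import Literature.NumberTheory.Automorphic.MirabolicEisensteinConvergence
import HarnessLib

/-!
# The majorant of the mirabolic Eisenstein series: general decaying test functions, and
polynomial growth along the positive real diagonal torus

Topic `NumberTheory/Automorphic`; namespace `Literature.NumberTheory.Automorphic`. Proof file
(theorems only), sequel to `MirabolicEisensteinConvergence` (absolute convergence of
`E(g, Φ; s) = |det g|^s ∑_ξ ∫ Φ(a ξ g) |a|^{ns} d^×a` on `re s > 1`, Jacquet–Shalika (1981), §4;
Cogdell (2004), §2.3). For the Rankin–Selberg integrals one needs, besides convergence, the
**moderate growth** of `E(·, Φ; s)` on Siegel sets (Cogdell (2004), §2.3, p. 211: the integral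
`I(s; φ, φ', Φ)` "converges absolutely for all `s` away from the poles of the Eisenstein series";
Godement–Jacquet, LNM 260 (1972), §11, Lemma 11.5–Prop. 11.7). This file supplies the elementary
half of it, for the majorant `𝓜(Φ, σ, g) = ∑_{ξ ∈ ℙ^{n-1}(K)} ∫_{𝔸_Kˣ} |Φ(a ξ g)| |a|^{nσ} dν(a)`:

* `tsum_lintegral_enorm_smul_lt_top_of_decay` — `𝓜(Φ, σ, g) < ∞` for `σ > 1` and **every**
  `Φ : 𝔸_Kⁿ → ℂ` with `a ↦ |Φ(a x)|` measurable, `|Φ(x)| ≤ M (1 + ‖x_∞‖)^{-k}` for some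
  `k > n [K:ℚ] σ`, and `Φ(x) = 0` unless `x_f` lies in a compact set (the proof of
  `MirabolicEisensteinConvergence` verbatim; this generality is what domination arguments need,
  e.g. `Φ₀ = (1 + ‖x_∞‖)^{-k} 𝟙_C(x_f)`);
* `tsum_lintegral_vecMul_posRealDiagonal_le` — **scaling along `A_T`**: for such a radially
  monotone `Φ₀` and a positive real diagonal matrix `d = diag(b₁, …, bₙ)` (`posRealDiagonal`) with
  `bᵢ ≥ m > 0`, `𝓜(Φ₀, σ, d) ≤ m^{-n [K:ℚ] σ} 𝓜(Φ₀, σ, 1)` (`‖(x d)_∞‖ ≥ m ‖x_∞‖`, the substitution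
  `a ↦ z(m)⁻¹ a` in the Haar integral and `|z(m)| = m^{[K:ℚ]}`);
* `exists_tsum_lintegral_vecMul_mul_le_of_mem` — **polynomial growth**: for `Φ ∈ 𝒮(𝔸_Kⁿ)`,
  `σ > 1` and a compact `C₁ ⊆ GL_n(𝔸_K)` there is `C < ∞` with
  `𝓜(Φ, σ, d c) ≤ C · m^{-n [K:ℚ] σ}` for all `c ∈ C₁` and all `d = diag(bᵢ)`, `bᵢ ≥ m > 0`
  (domination of the right translates `Φ(· c)`, `c ∈ C₁`, by one `Φ₀`).

Since `|E(g, Φ; s)| ≤ |det g|^{re s} 𝓜(Φ, re s, g)` termwise, this is the growth of the Eisenstein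
series along `A_T K` up to the factor `|det g|^{re s}`; the passage to a Siegel set
`ω A_{T₀}(t) K` (`ω a = a (a⁻¹ ω a)`, `ReductionTheoryGLnConjugation`) is left to the
Rankin–Selberg assembly. Folklore (Godement–Jacquet (1972), §11; Borel, *Introduction aux groupes
arithmétiques* (1969), §8).

## References

* R. Godement, H. Jacquet, *Zeta functions of simple algebras*, LNM 260 (1972), §11
  [GodementJacquetLNM260].
* J. W. Cogdell, *Analytic theory of L-functions for GL_n*, in *An Introduction to the Langlands
  Program* (2004), §2.3 [CogdellAnalyticTheory2004].
* H. Jacquet, J. A. Shalika, Amer. J. Math. 103 (1981), §4 [JacquetShalikaAJM1981].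
-/

noncomputable section

open scoped NNReal ENNReal Pointwise Classical RestrictedProduct
open NumberField NumberField.mixedEmbedding IsDedekindDomain Set MeasureTheory Measure Matrix Module

namespace Literature.NumberTheory.Automorphic

variable (K : Type) [Field K] [NumberField K] {n : ℕ}

/-! ### The majorant for general decaying `Φ` -/

/-- **The sup bound (general decaying `Φ`).** Let `Φ : 𝔸_Kⁿ → ℂ` satisfy
`|Φ(x)| ≤ M (1 + ‖x_∞‖)^{-k}` and vanish unless `x_f` lies in a compact set `C_f`, and let
`g ∈ GL_n(𝔸_K)`. There are `c > 0` and a compact set `C` of finite-adelic vectors such that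
for every `0 ≤ θ ≤ k`, every `r > 0` and every `y` in the dyadic set of representatives
`Y_r = z(r) P W` (`dyadicIdeleSet`),
`∑_{ξ ∈ Kⁿ ∖ 0} |Φ(y ξ g)| ≤ M (c r)^{-θ} ∑_{ξ ≠ 0, (ξ g)_f ∈ C} ‖(ξ g)_∞‖^{-θ}`:
the archimedean coordinates of `y ∈ Y_r` are `≥ c r` in size and its finite coordinates lie in
a fixed compact set, so `|Φ(y ξ g)| ≤ M (1 + c r ‖(ξ g)_∞‖)^{-k} 𝟙_C((ξ g)_f)`
(`IsStandardSchwartzBruhat.exists_norm_le_rpow_neg`, `exists_isCompact_eq_zero`), and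
`(1 + c r t)^{-k} ≤ (c r)^{-θ} t^{-θ}` (`one_add_mul_rpow_neg_le`). (Godement–Jacquet (1972),
proof of Lemma 11.5; Jacquet–Shalika (1981), §4.) The case of a standard Schwartz–Bruhat `Φ` is
`exists_tsum_enorm_smul_le` of `MirabolicEisensteinConvergence`. [cite: GodementJacquetLNM260, §11] -/
theorem exists_tsum_enorm_smul_le_of_decay (g : GL (Fin n) (AdeleRing (𝓞 K) K))
    {Φ : (Fin n → AdeleRing (𝓞 K) K) → ℂ} {k : ℕ} {M : ℝ} (hM0 : 0 ≤ M)
    (hM : ∀ x, ‖Φ x‖ ≤ M * (1 + ‖vecInfinitePart K n x‖) ^ (-(k : ℝ)))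
    {Cf : Set (Fin n → FiniteAdeleRing (𝓞 K) K)} (hCfc : IsCompact Cf)
    (hCf : ∀ x, vecFinitePart K n x ∉ Cf → Φ x = 0) :
    ∃ (c : ℝ) (C : Set (Fin n → FiniteAdeleRing (𝓞 K) K)), 0 < c ∧ IsCompact C ∧
      ∀ θ : ℝ, 0 ≤ θ → θ ≤ k → ∀ r : ℝ≥0ˣ, ∀ y ∈ dyadicIdeleSet K r,
        ∑' v : ↥{v : Fin n → K | v ≠ 0},
            ‖Φ (((y : (AdeleRing (𝓞 K) K)ˣ) : AdeleRing (𝓞 K) K) •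
              (ratVec K (v : Fin n → K) ᵥ* (g : Matrix (Fin n) (Fin n) (AdeleRing (𝓞 K) K))))‖ₑ ≤
          ENNReal.ofReal (M * (c * ((r : ℝ≥0) : ℝ)) ^ (-θ)) *
            ∑' v : ↥{v : Fin n → K | v ≠ 0 ∧
                vecFinitePart K n (ratVec K v ᵥ* (g : Matrix (Fin n) (Fin n) (AdeleRing (𝓞 K) K))) ∈ C},
              ENNReal.ofReal (‖vecInfinitePart K n (ratVec K (v : Fin n → K) ᵥ*
                (g : Matrix (Fin n) (Fin n) (AdeleRing (𝓞 K) K)))‖ ^ (-θ)) := by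
  -- the compact set `Q = P W` and a bound `B` for `‖(q⁻¹)_∞‖`, `q ∈ Q`
  set Q : Set (GaloisRepresentations.ideleGroup K) := posRealIdeleSegment K * normOneIdeleCover K
    with hQ
  have hQc : IsCompact Q := (isCompact_posRealIdeleSegment K).mul (isCompact_normOneIdeleCover K)
  have hcont : Continuous fun q : GaloisRepresentations.ideleGroup K =>
      InfiniteAdeleRing.ringEquiv_mixedSpace K ((q⁻¹ : GaloisRepresentations.ideleGroup K) : AdeleRing (𝓞 K) K).1 :=
    (continuous_ringEquiv_mixedSpace K).comp (continuous_fst.comp Units.continuous_coe_inv)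
  obtain ⟨B, hB⟩ := hQc.exists_bound_of_continuousOn hcont.continuousOn
  set B' : ℝ := max B 1 with hB'
  have hB'1 : 1 ≤ B' := le_max_right _ _
  have hB'0 : 0 < B' := one_pos.trans_le hB'1
  have hBq : ∀ q ∈ Q, ‖InfiniteAdeleRing.ringEquiv_mixedSpace K
      ((q⁻¹ : GaloisRepresentations.ideleGroup K) : AdeleRing (𝓞 K) K).1‖ ≤ B' :=
    fun q hq => (hB q hq).trans (le_max_left _ _)
  -- the compact set of finite parts
  set F : GaloisRepresentations.ideleGroup K × (Fin n → FiniteAdeleRing (𝓞 K) K) →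
      (Fin n → FiniteAdeleRing (𝓞 K) K) := fun p =>
    ((p.1⁻¹ : GaloisRepresentations.ideleGroup K) : AdeleRing (𝓞 K) K).2 • p.2 with hF
  have hFc : Continuous F :=
    (continuous_snd.comp (Units.continuous_coe_inv.comp continuous_fst)).smul continuous_snd
  set C : Set (Fin n → FiniteAdeleRing (𝓞 K) K) := F '' (Q ×ˢ Cf) with hC
  have hCc : IsCompact C := (hQc.prod hCfc).image hFc
  refine ⟨B'⁻¹, C, inv_pos.2 hB'0, hCc, fun θ hθ0 hθk r y hy => ?_⟩
  obtain ⟨q, hq, rfl⟩ := Set.mem_smul_set.1 hy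
  rw [smul_eq_mul]
  have hr0 : 0 < ((r : ℝ≥0) : ℝ) := NNReal.coe_pos.2 (pos_iff_ne_zero.2 r.ne_zero)
  have hrB : 0 < B'⁻¹ * ((r : ℝ≥0) : ℝ) := mul_pos (inv_pos.2 hB'0) hr0
  -- notation for the lattice data
  set Λ : Set (Fin n → K) := {v : Fin n → K | v ≠ 0 ∧
    vecFinitePart K n (ratVec K v ᵥ* (g : Matrix (Fin n) (Fin n) (AdeleRing (𝓞 K) K))) ∈ C} with hΛ
  set N : (Fin n → K) → ℝ := fun v =>
    ‖vecInfinitePart K n (ratVec K v ᵥ* (g : Matrix (Fin n) (Fin n) (AdeleRing (𝓞 K) K)))‖ with hN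
  set A : ℝ≥0∞ := ENNReal.ofReal (M * (B'⁻¹ * ((r : ℝ≥0) : ℝ)) ^ (-θ)) with hA
  set G : (Fin n → K) → ℝ≥0∞ := fun v => A * ENNReal.ofReal (N v ^ (-θ)) with hG
  -- pointwise bound
  have hpt : ∀ v : Fin n → K, v ≠ 0 →
      (‖Φ (((posRealIdele K r * q : GaloisRepresentations.ideleGroup K) : AdeleRing (𝓞 K) K) •
        (ratVec K v ᵥ* (g : Matrix (Fin n) (Fin n) (AdeleRing (𝓞 K) K))))‖ₑ : ℝ≥0∞) ≤
        Λ.indicator G v := by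
    intro v hv
    by_cases hvΛ : v ∈ Λ
    · rw [indicator_of_mem hvΛ]
      have hNpos : 0 < N v := norm_vecInfinitePart_ratVec_vecMul_pos K hv g
      have hlow : B'⁻¹ * ((r : ℝ≥0) : ℝ) * N v ≤
          ‖vecInfinitePart K n (((posRealIdele K r * q : GaloisRepresentations.ideleGroup K) :
            AdeleRing (𝓞 K) K) • (ratVec K v ᵥ* (g : Matrix (Fin n) (Fin n) (AdeleRing (𝓞 K) K))))‖ := by
        rw [vecInfinitePart_posRealIdele_mul_smul, _root_.norm_smul, Real.norm_of_nonneg hr0.le,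
          mul_assoc, mul_left_comm]
        refine mul_le_mul_of_nonneg_left ?_ hr0.le
        rw [inv_mul_le_iff₀ hB'0]
        calc N v = ‖InfiniteAdeleRing.ringEquiv_mixedSpace K
              ((q⁻¹ : GaloisRepresentations.ideleGroup K) : AdeleRing (𝓞 K) K).1 •
              (InfiniteAdeleRing.ringEquiv_mixedSpace K (q : AdeleRing (𝓞 K) K).1 •
                vecInfinitePart K n (ratVec K v ᵥ* (g : Matrix (Fin n) (Fin n) (AdeleRing (𝓞 K) K))))‖ := by
              rw [ringEquiv_inv_fst_smul_smul]
          _ ≤ ‖InfiniteAdeleRing.ringEquiv_mixedSpace K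
              ((q⁻¹ : GaloisRepresentations.ideleGroup K) : AdeleRing (𝓞 K) K).1‖ *
              ‖InfiniteAdeleRing.ringEquiv_mixedSpace K (q : AdeleRing (𝓞 K) K).1 •
                vecInfinitePart K n (ratVec K v ᵥ* (g : Matrix (Fin n) (Fin n) (AdeleRing (𝓞 K) K)))‖ :=
              norm_smul_le _ _
          _ ≤ B' * ‖InfiniteAdeleRing.ringEquiv_mixedSpace K (q : AdeleRing (𝓞 K) K).1 •
                vecInfinitePart K n (ratVec K v ᵥ* (g : Matrix (Fin n) (Fin n) (AdeleRing (𝓞 K) K)))‖ :=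
              mul_le_mul_of_nonneg_right (hBq q hq) (norm_nonneg _)
      exact enorm_le_ofReal_mul_ofReal hM0 hrB
        (le_mul_rpow_neg_mul_rpow_neg hM0 (hM _) hrB hNpos hlow hθ0 hθk)
    · rw [indicator_of_notMem hvΛ]
      have hnot : vecFinitePart K n (ratVec K v ᵥ* (g : Matrix (Fin n) (Fin n) (AdeleRing (𝓞 K) K))) ∉ C :=
        fun h => hvΛ ⟨hv, h⟩
      have hzero : Φ (((posRealIdele K r * q : GaloisRepresentations.ideleGroup K) : AdeleRing (𝓞 K) K) •
          (ratVec K v ᵥ* (g : Matrix (Fin n) (Fin n) (AdeleRing (𝓞 K) K)))) = 0 := by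
        refine hCf _ fun hmem => hnot ?_
        rw [vecFinitePart_posRealIdele_mul_smul] at hmem
        rw [← idele_inv_snd_smul_smul K q
          (vecFinitePart K n (ratVec K v ᵥ* (g : Matrix (Fin n) (Fin n) (AdeleRing (𝓞 K) K))))]
        exact ⟨(q, (q : AdeleRing (𝓞 K) K).2 •
          vecFinitePart K n (ratVec K v ᵥ* (g : Matrix (Fin n) (Fin n) (AdeleRing (𝓞 K) K)))),
          ⟨hq, hmem⟩, rfl⟩
      rw [hzero, enorm_zero]
  -- summation
  have hΛsub : {v : Fin n → K | v ≠ 0} ∩ Λ = Λ := Set.inter_eq_right.2 fun v hv => hv.1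
  calc ∑' v : ↥{v : Fin n → K | v ≠ 0},
        (‖Φ (((posRealIdele K r * q : GaloisRepresentations.ideleGroup K) : AdeleRing (𝓞 K) K) •
          (ratVec K (v : Fin n → K) ᵥ* (g : Matrix (Fin n) (Fin n) (AdeleRing (𝓞 K) K))))‖ₑ : ℝ≥0∞)
      ≤ ∑' v : ↥{v : Fin n → K | v ≠ 0}, Λ.indicator G v :=
        ENNReal.tsum_le_tsum fun v => hpt v.1 v.2
    _ = ∑' v : Fin n → K, {v : Fin n → K | v ≠ 0}.indicator (Λ.indicator G) v :=
        tsum_subtype {v : Fin n → K | v ≠ 0} (Λ.indicator G)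
    _ = ∑' v : Fin n → K, Λ.indicator G v := by rw [Set.indicator_indicator, hΛsub]
    _ = ∑' v : Λ, G v := (tsum_subtype Λ G).symm
    _ = A * ∑' v : Λ, ENNReal.ofReal (N v ^ (-θ)) := by
        simp only [hG]
        exact ENNReal.tsum_mul_left


/-- The majorant `a ↦ |Φ(a x)| · |a|^τ` is measurable on `𝔸_Kˣ` as soon as `a ↦ |Φ(a x)|` is.
[folklore] -/
theorem measurable_enorm_apply_smul_mul' [MeasurableSpace (AdeleRing (𝓞 K) K)]
    [BorelSpace (AdeleRing (𝓞 K) K)] {Φ : (Fin n → AdeleRing (𝓞 K) K) → ℂ}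
    (x : Fin n → AdeleRing (𝓞 K) K)
    (hmeas : Measurable fun a : GaloisRepresentations.ideleGroup K =>
      (‖Φ ((a : AdeleRing (𝓞 K) K) • x)‖ₑ : ℝ≥0∞)) (τ : ℝ) :
    Measurable fun a : GaloisRepresentations.ideleGroup K =>
      (‖Φ ((a : AdeleRing (𝓞 K) K) • x)‖ₑ : ℝ≥0∞) *
        ENNReal.ofReal ((IdeleClassGroup.ideleNorm K a : ℝ) ^ τ) := by
  haveI := borelSpace_ideleGroup K
  have hc : Continuous fun a : GaloisRepresentations.ideleGroup K => (IdeleClassGroup.ideleNorm K a : ℝ) :=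
    NNReal.continuous_coe.comp (continuous_ideleNorm_holds K)
  refine hmeas.mul (ENNReal.measurable_ofReal.comp ?_)
  exact (hc.rpow_const fun a => Or.inl (NNReal.coe_ne_zero.2 (ideleNorm_ne_zero a))).measurable

/-- The theta-type majorant `a ↦ ∑_p |Φ(a x_p)| |a|^τ` is measurable. [folklore] -/
theorem measurable_tsum_enorm_apply_smul_mul' [MeasurableSpace (AdeleRing (𝓞 K) K)]
    [BorelSpace (AdeleRing (𝓞 K) K)] {Φ : (Fin n → AdeleRing (𝓞 K) K) → ℂ}
    (hmeas : ∀ x : Fin n → AdeleRing (𝓞 K) K, Measurable fun a : GaloisRepresentations.ideleGroup K =>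
      (‖Φ ((a : AdeleRing (𝓞 K) K) • x)‖ₑ : ℝ≥0∞))
    (x : Projectivization K (Fin n → K) → Fin n → AdeleRing (𝓞 K) K) (τ : ℝ) :
    Measurable fun a : GaloisRepresentations.ideleGroup K =>
      ∑' p : Projectivization K (Fin n → K), (‖Φ ((a : AdeleRing (𝓞 K) K) • x p)‖ₑ : ℝ≥0∞) *
        ENNReal.ofReal ((IdeleClassGroup.ideleNorm K a : ℝ) ^ τ) := by
  haveI := countable_projectivization K (n := n)
  have h := fun p => measurable_enorm_apply_smul_mul' K (x p) (hmeas (x p)) τ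
  simp_rw [ENNReal.tsum_eq_iSup_sum]
  exact Measurable.iSup fun s => s.measurable_fun_sum fun p _ => h p

/-- **One dyadic shell** (variant of `setLIntegral_shell_le` of `MirabolicEisensteinConvergence` with
measurability in place of continuity). For a left-invariant measure `ν` on `𝔸_Kˣ`, `τ ≥ 0`
and the sup bound of `exists_tsum_enorm_smul_le` (constants `M, c`, set `C`, order `k`), for
every `0 ≤ θ ≤ k` and `r > 0`:
`∫_{‖a‖ ∈ [r^d/2, 4 r^d]} ∑_p |Φ(a ξ_p g)| |a|^τ dν ≤
  ν(P W) · (4 r^d)^τ M (c r)^{-θ} · ∑_{ξ ≠ 0, (ξ g)_f ∈ C} ‖(ξ g)_∞‖^{-θ}`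
(unfold the shell over `Kˣ` onto `Y_r`, `lintegral_shell_le_lintegral_dyadicIdeleSet_tsum`;
`|k y| = |y| ≤ 4 r^d`; reindex `(k, p) ↦ k p.rep`, `tsum_tsum_smul_rep_le`; apply the sup bound;
`ν(Y_r) = ν(P W)`, `measure_dyadicIdeleSet`). [cite: GodementJacquetLNM260, §11] -/
theorem setLIntegral_shell_le' [MeasurableSpace (AdeleRing (𝓞 K) K)] [BorelSpace (AdeleRing (𝓞 K) K)]
    (ν : Measure (GaloisRepresentations.ideleGroup K)) [ν.IsMulLeftInvariant]
    (g : GL (Fin n) (AdeleRing (𝓞 K) K)) {Φ : (Fin n → AdeleRing (𝓞 K) K) → ℂ}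
    (hmeas : ∀ x : Fin n → AdeleRing (𝓞 K) K, Measurable fun a : GaloisRepresentations.ideleGroup K =>
      (‖Φ ((a : AdeleRing (𝓞 K) K) • x)‖ₑ : ℝ≥0∞))
    {M c : ℝ} {C : Set (Fin n → FiniteAdeleRing (𝓞 K) K)} {k : ℕ}
    (hsup : ∀ θ : ℝ, 0 ≤ θ → θ ≤ k → ∀ r : ℝ≥0ˣ, ∀ y ∈ dyadicIdeleSet K r,
        ∑' v : ↥{v : Fin n → K | v ≠ 0},
            ‖Φ (((y : (AdeleRing (𝓞 K) K)ˣ) : AdeleRing (𝓞 K) K) •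
              (ratVec K (v : Fin n → K) ᵥ* (g : Matrix (Fin n) (Fin n) (AdeleRing (𝓞 K) K))))‖ₑ ≤
          ENNReal.ofReal (M * (c * ((r : ℝ≥0) : ℝ)) ^ (-θ)) *
            ∑' v : ↥{v : Fin n → K | v ≠ 0 ∧
                vecFinitePart K n (ratVec K v ᵥ* (g : Matrix (Fin n) (Fin n) (AdeleRing (𝓞 K) K))) ∈ C},
              ENNReal.ofReal (‖vecInfinitePart K n (ratVec K (v : Fin n → K) ᵥ*
                (g : Matrix (Fin n) (Fin n) (AdeleRing (𝓞 K) K)))‖ ^ (-θ)))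
    {τ : ℝ} (hτ : 0 ≤ τ) {θ : ℝ} (hθ0 : 0 ≤ θ) (hθk : θ ≤ k) (r : ℝ≥0ˣ) :
    ∫⁻ a in {x : GaloisRepresentations.ideleGroup K |
        ((r : ℝ≥0) : ℝ) ^ finrank ℚ K / 2 ≤ (IdeleClassGroup.ideleNorm K x : ℝ) ∧
          (IdeleClassGroup.ideleNorm K x : ℝ) ≤ 4 * ((r : ℝ≥0) : ℝ) ^ finrank ℚ K},
      ∑' p : Projectivization K (Fin n → K),
        (‖Φ ((a : AdeleRing (𝓞 K) K) •
          (ratVec K p.rep ᵥ* (g : Matrix (Fin n) (Fin n) (AdeleRing (𝓞 K) K))))‖ₑ : ℝ≥0∞) *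
          ENNReal.ofReal ((IdeleClassGroup.ideleNorm K a : ℝ) ^ τ) ∂ν ≤
      ν (posRealIdeleSegment K * normOneIdeleCover K) *
        ENNReal.ofReal ((4 * ((r : ℝ≥0) : ℝ) ^ finrank ℚ K) ^ τ * (M * (c * ((r : ℝ≥0) : ℝ)) ^ (-θ))) *
        ∑' v : ↥{v : Fin n → K | v ≠ 0 ∧
            vecFinitePart K n (ratVec K v ᵥ* (g : Matrix (Fin n) (Fin n) (AdeleRing (𝓞 K) K))) ∈ C},
          ENNReal.ofReal (‖vecInfinitePart K n (ratVec K (v : Fin n → K) ᵥ*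
            (g : Matrix (Fin n) (Fin n) (AdeleRing (𝓞 K) K)))‖ ^ (-θ)) := by
  haveI := borelSpace_ideleGroup K
  -- notation
  set Z : ℝ≥0∞ := ∑' v : ↥{v : Fin n → K | v ≠ 0 ∧
      vecFinitePart K n (ratVec K v ᵥ* (g : Matrix (Fin n) (Fin n) (AdeleRing (𝓞 K) K))) ∈ C},
    ENNReal.ofReal (‖vecInfinitePart K n (ratVec K (v : Fin n → K) ᵥ*
      (g : Matrix (Fin n) (Fin n) (AdeleRing (𝓞 K) K)))‖ ^ (-θ)) with hZ
  set F : GaloisRepresentations.ideleGroup K → ℝ≥0∞ := fun a =>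
    ∑' p : Projectivization K (Fin n → K),
      (‖Φ ((a : AdeleRing (𝓞 K) K) •
        (ratVec K p.rep ᵥ* (g : Matrix (Fin n) (Fin n) (AdeleRing (𝓞 K) K))))‖ₑ : ℝ≥0∞) *
        ENNReal.ofReal ((IdeleClassGroup.ideleNorm K a : ℝ) ^ τ) with hF
  have hFm : Measurable F := measurable_tsum_enorm_apply_smul_mul' K hmeas _ τ
  set bound : ℝ≥0∞ :=
    ENNReal.ofReal ((4 * ((r : ℝ≥0) : ℝ) ^ finrank ℚ K) ^ τ * (M * (c * ((r : ℝ≥0) : ℝ)) ^ (-θ))) * Z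
    with hbound
  -- the pointwise bound on `Y_r`
  have hpt : ∀ y ∈ dyadicIdeleSet K r, ∑' k : Kˣ, F (principalIdele K k * y) ≤ bound := by
    intro y hy
    have hnorm1 : ∀ k : Kˣ, IdeleClassGroup.ideleNorm K (principalIdele K k * y) =
        IdeleClassGroup.ideleNorm K y := fun k => by
      rw [map_mul, ideleNorm_principalIdele_eq_one, one_mul]
    have hterm : ∀ (k : Kˣ) (p : Projectivization K (Fin n → K)),
        (‖Φ (((principalIdele K k * y : GaloisRepresentations.ideleGroup K) : AdeleRing (𝓞 K) K) •
          (ratVec K p.rep ᵥ* (g : Matrix (Fin n) (Fin n) (AdeleRing (𝓞 K) K))))‖ₑ : ℝ≥0∞) *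
          ENNReal.ofReal ((IdeleClassGroup.ideleNorm K (principalIdele K k * y) : ℝ) ^ τ) =
        (‖Φ ((y : AdeleRing (𝓞 K) K) •
          (ratVec K ((k : K) • p.rep) ᵥ* (g : Matrix (Fin n) (Fin n) (AdeleRing (𝓞 K) K))))‖ₑ : ℝ≥0∞) *
          ENNReal.ofReal ((IdeleClassGroup.ideleNorm K y : ℝ) ^ τ) := by
      intro k p
      rw [hnorm1, Units.val_mul, mul_comm ((principalIdele K k : GaloisRepresentations.ideleGroup K) :
        AdeleRing (𝓞 K) K), mul_smul, principalIdele_smul_ratVec_vecMul]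
    have hy4 : (IdeleClassGroup.ideleNorm K y : ℝ) ^ τ ≤ (4 * ((r : ℝ≥0) : ℝ) ^ finrank ℚ K) ^ τ :=
      Real.rpow_le_rpow (NNReal.coe_nonneg _) (ideleNorm_mem_of_mem_dyadicIdeleSet K hy).2 hτ
    calc ∑' k : Kˣ, F (principalIdele K k * y)
        = ∑' k : Kˣ, ∑' p : Projectivization K (Fin n → K),
            (‖Φ ((y : AdeleRing (𝓞 K) K) •
              (ratVec K ((k : K) • p.rep) ᵥ* (g : Matrix (Fin n) (Fin n) (AdeleRing (𝓞 K) K))))‖ₑ : ℝ≥0∞) *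
              ENNReal.ofReal ((IdeleClassGroup.ideleNorm K y : ℝ) ^ τ) := by
          simp only [hF, hterm]
      _ = (∑' k : Kˣ, ∑' p : Projectivization K (Fin n → K),
            (‖Φ ((y : AdeleRing (𝓞 K) K) •
              (ratVec K ((k : K) • p.rep) ᵥ* (g : Matrix (Fin n) (Fin n) (AdeleRing (𝓞 K) K))))‖ₑ : ℝ≥0∞)) *
            ENNReal.ofReal ((IdeleClassGroup.ideleNorm K y : ℝ) ^ τ) := by
          rw [← ENNReal.tsum_mul_right]
          refine tsum_congr fun k => ?_
          rw [ENNReal.tsum_mul_right]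
      _ ≤ (∑' v : ↥{v : Fin n → K | v ≠ 0},
            (‖Φ ((y : AdeleRing (𝓞 K) K) •
              (ratVec K (v : Fin n → K) ᵥ* (g : Matrix (Fin n) (Fin n) (AdeleRing (𝓞 K) K))))‖ₑ : ℝ≥0∞)) *
            ENNReal.ofReal ((4 * ((r : ℝ≥0) : ℝ) ^ finrank ℚ K) ^ τ) :=
          mul_le_mul' (tsum_tsum_smul_rep_le K fun v =>
            (‖Φ ((y : AdeleRing (𝓞 K) K) •
              (ratVec K v ᵥ* (g : Matrix (Fin n) (Fin n) (AdeleRing (𝓞 K) K))))‖ₑ : ℝ≥0∞))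
            (ENNReal.ofReal_le_ofReal hy4)
      _ ≤ (ENNReal.ofReal (M * (c * ((r : ℝ≥0) : ℝ)) ^ (-θ)) * Z) *
            ENNReal.ofReal ((4 * ((r : ℝ≥0) : ℝ) ^ finrank ℚ K) ^ τ) :=
          mul_le_mul' (hsup θ hθ0 hθk r y hy) le_rfl
      _ = bound := by
          rw [hbound, ENNReal.ofReal_mul (Real.rpow_nonneg (by positivity) _)]
          ring
  calc ∫⁻ a in {x : GaloisRepresentations.ideleGroup K |
        ((r : ℝ≥0) : ℝ) ^ finrank ℚ K / 2 ≤ (IdeleClassGroup.ideleNorm K x : ℝ) ∧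
          (IdeleClassGroup.ideleNorm K x : ℝ) ≤ 4 * ((r : ℝ≥0) : ℝ) ^ finrank ℚ K}, F a ∂ν
      ≤ ∫⁻ y in dyadicIdeleSet K r, ∑' k : Kˣ, F (principalIdele K k * y) ∂ν :=
        lintegral_shell_le_lintegral_dyadicIdeleSet_tsum K ν r hFm
    _ ≤ ∫⁻ y in dyadicIdeleSet K r, bound ∂ν :=
        setLIntegral_mono' (measurableSet_dyadicIdeleSet K r) fun y hy => hpt y hy
    _ = bound * ν (dyadicIdeleSet K r) := setLIntegral_const _ _
    _ = ν (posRealIdeleSegment K * normOneIdeleCover K) *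
        ENNReal.ofReal ((4 * ((r : ℝ≥0) : ℝ) ^ finrank ℚ K) ^ τ * (M * (c * ((r : ℝ≥0) : ℝ)) ^ (-θ))) * Z := by
        rw [measure_dyadicIdeleSet, hbound]
        ring

/-! ### Bookkeeping of the exponents and the two geometric series -/

/-- **The majorant is finite for decaying `Φ` and `σ > 1`** (general form of
`tsum_lintegral_enorm_smul_lt_top` of `MirabolicEisensteinConvergence`: only measurability of
`a ↦ |Φ(a x)|`, archimedean decay of some order `k > n [K:ℚ] σ` and compact support in the finite
coordinates are used). For a Haar measure `ν` on `𝔸_Kˣ`, `g ∈ GL_n(𝔸_K)` and `σ > 1`,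
`∑_{p ∈ ℙ^{n-1}(K)} ∫_{𝔸_Kˣ} |Φ(a ξ_p g)| |a|^{nσ} dν(a) < ∞`.
Proof: Tonelli; cover `𝔸_Kˣ` by the shells `‖a‖ ∈ [2^{j-1}, 2^{j+2}]` (`r_j = 2^{j/[K:ℚ]}`); bound
each shell by `setLIntegral_shell_le'` with `θ = k` for `j ≥ 0` and
`θ = n [K:ℚ] (1 + σ)/2 ∈ (n [K:ℚ], n [K:ℚ] σ)` for `j < 0`, where the lattice sums are finite
(`tsum_norm_vecInfinitePart_rpow_neg_lt_top`); the two resulting series in `j` are geometric with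
ratios `2^{nσ - k/[K:ℚ]} < 1` and `2^{-(nσ - θ/[K:ℚ])} < 1`. (Godement–Jacquet (1972), Lemma 11.5
and Prop. 11.7; Jacquet–Shalika (1981), §4; Cogdell (2004), §2.3.)
[cite: GodementJacquetLNM260, §11] -/
theorem tsum_lintegral_enorm_smul_lt_top_of_decay [MeasurableSpace (AdeleRing (𝓞 K) K)]
    [BorelSpace (AdeleRing (𝓞 K) K)] (ν : Measure (GaloisRepresentations.ideleGroup K)) [ν.IsHaarMeasure]
    (g : GL (Fin n) (AdeleRing (𝓞 K) K)) {Φ : (Fin n → AdeleRing (𝓞 K) K) → ℂ}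
    (hmeas : ∀ x : Fin n → AdeleRing (𝓞 K) K, Measurable fun a : GaloisRepresentations.ideleGroup K =>
      (‖Φ ((a : AdeleRing (𝓞 K) K) • x)‖ₑ : ℝ≥0∞))
    {k : ℕ} {M : ℝ} (hM0 : 0 ≤ M)
    (hM : ∀ x, ‖Φ x‖ ≤ M * (1 + ‖vecInfinitePart K n x‖) ^ (-(k : ℝ)))
    {Cf : Set (Fin n → FiniteAdeleRing (𝓞 K) K)} (hCfc : IsCompact Cf)
    (hCf : ∀ x, vecFinitePart K n x ∉ Cf → Φ x = 0) {σ : ℝ} (hσ : 1 < σ)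
    (hk : (n : ℝ) * finrank ℚ K * σ < k) :
    ∑' p : Projectivization K (Fin n → K),
      ∫⁻ a, (‖Φ ((a : AdeleRing (𝓞 K) K) •
          (ratVec K p.rep ᵥ* (g : Matrix (Fin n) (Fin n) (AdeleRing (𝓞 K) K))))‖ₑ : ℝ≥0∞) *
        ENNReal.ofReal ((IdeleClassGroup.ideleNorm K a : ℝ) ^ ((n : ℝ) * σ)) ∂ν < ⊤ := by
  haveI := borelSpace_ideleGroup K
  haveI := countable_projectivization K (n := n)
  rcases Nat.eq_zero_or_pos n with rfl | hn
  · haveI : IsEmpty (Projectivization K (Fin 0 → K)) :=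
      ⟨fun p => p.rep_nonzero (Subsingleton.elim _ _)⟩
    rw [tsum_empty]
    exact ENNReal.zero_lt_top
  -- the parameters (`D = [K:ℚ]`)
  have hd : 0 < finrank ℚ K := Module.finrank_pos
  have hdR : (0 : ℝ) < finrank ℚ K := Nat.cast_pos.2 hd
  have hnR : (0 : ℝ) < n := Nat.cast_pos.2 hn
  set τ : ℝ := (n : ℝ) * σ with hτ
  have hτ0 : 0 ≤ τ := by positivity
  set θm : ℝ := (n : ℝ) * finrank ℚ K * (1 + σ) / 2 with hθm
  have hndpos : (0 : ℝ) < n * finrank ℚ K := mul_pos hnR hdR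
  have hθm1 : (n : ℝ) * finrank ℚ K < θm := by rw [hθm]; nlinarith
  have hθm2 : θm < (n : ℝ) * finrank ℚ K * σ := by rw [hθm]; nlinarith
  have hθm0 : 0 ≤ θm := by positivity
  have hθmk : θm ≤ k := by linarith
  have hkD : (n : ℝ) * finrank ℚ K < k := by nlinarith
  -- the sup bound and the lattice sums
  obtain ⟨c, C, hc, hCc, hsup⟩ := exists_tsum_enorm_smul_le_of_decay K g hM0 hM hCfc hCf
  set Zf : ℝ → ℝ≥0∞ := fun θ => ∑' v : ↥{v : Fin n → K | v ≠ 0 ∧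
      vecFinitePart K n (ratVec K v ᵥ* (g : Matrix (Fin n) (Fin n) (AdeleRing (𝓞 K) K))) ∈ C},
    ENNReal.ofReal (‖vecInfinitePart K n (ratVec K (v : Fin n → K) ᵥ*
      (g : Matrix (Fin n) (Fin n) (AdeleRing (𝓞 K) K)))‖ ^ (-θ)) with hZf
  have hZ : ∀ θ : ℝ, (n : ℝ) * finrank ℚ K < θ → Zf θ < ⊤ := fun θ hθ =>
    tsum_norm_vecInfinitePart_rpow_neg_lt_top K g hCc hθ
  -- Tonelli
  have hmeasp : ∀ p : Projectivization K (Fin n → K), Measurable fun a : GaloisRepresentations.ideleGroup K =>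
      (‖Φ ((a : AdeleRing (𝓞 K) K) •
          (ratVec K p.rep ᵥ* (g : Matrix (Fin n) (Fin n) (AdeleRing (𝓞 K) K))))‖ₑ : ℝ≥0∞) *
        ENNReal.ofReal ((IdeleClassGroup.ideleNorm K a : ℝ) ^ τ) :=
    fun p => measurable_enorm_apply_smul_mul' K _ (hmeas _) τ
  rw [← lintegral_tsum fun p => (hmeasp p).aemeasurable]
  set F : GaloisRepresentations.ideleGroup K → ℝ≥0∞ := fun a =>
    ∑' p : Projectivization K (Fin n → K),
      (‖Φ ((a : AdeleRing (𝓞 K) K) •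
        (ratVec K p.rep ᵥ* (g : Matrix (Fin n) (Fin n) (AdeleRing (𝓞 K) K))))‖ₑ : ℝ≥0∞) *
        ENNReal.ofReal ((IdeleClassGroup.ideleNorm K a : ℝ) ^ τ) with hF
  -- the radii `r_j = 2^{j/finrank ℚ K}` and the shells
  have hrpos : ∀ j : ℤ, (0 : ℝ) < (2 : ℝ) ^ ((j : ℝ) / finrank ℚ K) := fun j => Real.rpow_pos_of_pos two_pos _
  set r : ℤ → ℝ≥0ˣ := fun j =>
    Units.mk0 ⟨(2 : ℝ) ^ ((j : ℝ) / finrank ℚ K), (hrpos j).le⟩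
      (by rw [Ne, ← NNReal.coe_eq_zero]; exact (hrpos j).ne') with hr
  have hrj : ∀ j : ℤ, (((r j : ℝ≥0ˣ) : ℝ≥0) : ℝ) = (2 : ℝ) ^ ((j : ℝ) / finrank ℚ K) := fun j => rfl
  have hrjd : ∀ j : ℤ, (((r j : ℝ≥0ˣ) : ℝ≥0) : ℝ) ^ finrank ℚ K = (2 : ℝ) ^ (j : ℝ) := fun j => by
    rw [hrj, ← Real.rpow_natCast, ← Real.rpow_mul two_pos.le,
      div_mul_cancel₀ _ (Nat.cast_ne_zero.2 hd.ne')]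
  set shell : ℤ → Set (GaloisRepresentations.ideleGroup K) := fun j =>
    {x | (((r j : ℝ≥0ˣ) : ℝ≥0) : ℝ) ^ finrank ℚ K / 2 ≤ (IdeleClassGroup.ideleNorm K x : ℝ) ∧
      (IdeleClassGroup.ideleNorm K x : ℝ) ≤ 4 * (((r j : ℝ≥0ˣ) : ℝ≥0) : ℝ) ^ finrank ℚ K} with hshell
  have hcover : (univ : Set (GaloisRepresentations.ideleGroup K)) ⊆ ⋃ j, shell j := by
    intro a _
    set x : ℝ := (IdeleClassGroup.ideleNorm K a : ℝ) with hx
    have hx0 : 0 < x := NNReal.coe_pos.2 (pos_iff_ne_zero.2 (ideleNorm_ne_zero a))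
    set j : ℤ := ⌊Real.logb 2 x⌋ with hj
    have h1 : (2 : ℝ) ^ (j : ℝ) ≤ x := by
      calc (2 : ℝ) ^ (j : ℝ) ≤ (2 : ℝ) ^ Real.logb 2 x :=
            Real.rpow_le_rpow_of_exponent_le (by norm_num) (Int.floor_le _)
        _ = x := Real.rpow_logb two_pos (by norm_num) hx0
    have h2 : x < (2 : ℝ) ^ ((j : ℝ) + 1) := by
      calc x = (2 : ℝ) ^ Real.logb 2 x := (Real.rpow_logb two_pos (by norm_num) hx0).symm
        _ < (2 : ℝ) ^ ((j : ℝ) + 1) :=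
            Real.rpow_lt_rpow_of_exponent_lt (by norm_num) (Int.lt_floor_add_one _)
    rw [Real.rpow_add_one two_ne_zero] at h2
    refine mem_iUnion.2 ⟨j, ?_, ?_⟩
    · rw [hrjd]
      have : (0 : ℝ) ≤ (2 : ℝ) ^ (j : ℝ) := Real.rpow_nonneg two_pos.le _
      linarith
    · rw [hrjd]
      have : (0 : ℝ) ≤ (2 : ℝ) ^ (j : ℝ) := Real.rpow_nonneg two_pos.le _
      linarith
  -- the bound on each shell
  have hV : ν (posRealIdeleSegment K * normOneIdeleCover K) < ⊤ :=
    ((isCompact_posRealIdeleSegment K).mul (isCompact_normOneIdeleCover K)).measure_lt_top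
  have hshellb : ∀ θ : ℝ, 0 ≤ θ → θ ≤ k → ∀ j : ℤ, ∫⁻ a in shell j, F a ∂ν ≤
      ν (posRealIdeleSegment K * normOneIdeleCover K) *
        ENNReal.ofReal (4 ^ τ * M * c ^ (-θ) * (2 : ℝ) ^ ((j : ℝ) * (τ - θ / finrank ℚ K))) * Zf θ := by
    intro θ hθ0 hθk j
    have h := setLIntegral_shell_le' K ν g hmeas hsup hτ0 hθ0 hθk (r j)
    rw [hrj, shell_const_eq hc M τ θ hd j] at h
    exact h
  -- the two halves
  have hplus : ∑' m : ℕ, ∫⁻ a in shell (m : ℤ), F a ∂ν < ⊤ := by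
    set ρ : ℝ := (2 : ℝ) ^ (τ - k / finrank ℚ K) with hρ
    have hρ0 : 0 ≤ ρ := Real.rpow_nonneg two_pos.le _
    have hρ1 : ρ < 1 := by
      refine Real.rpow_lt_one_of_one_lt_of_neg (by norm_num) ?_
      rw [sub_neg, lt_div_iff₀ hdR, hτ]
      nlinarith
    have hgeom : ∀ m : ℕ, (2 : ℝ) ^ (((m : ℤ) : ℝ) * (τ - k / finrank ℚ K)) = ρ ^ m := fun m => by
      rw [hρ, ← Real.rpow_natCast, ← Real.rpow_mul two_pos.le, Int.cast_natCast]
      congr 1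
      ring
    refine lt_of_le_of_lt (ENNReal.tsum_le_tsum fun m => hshellb k (Nat.cast_nonneg k) le_rfl m) ?_
    refine lt_of_le_of_lt (ENNReal.tsum_le_tsum fun m => le_of_eq ?_)
      (tsum_mul_ofReal_mul_pow_mul_lt_top hV.ne (hZ k hkD).ne
        (A := 4 ^ τ * M * c ^ (-(k : ℝ))) (by positivity) hρ0 hρ1)
    rw [hgeom m]
  have hminus : ∑' m : ℕ, ∫⁻ a in shell (-(m + 1 : ℤ)), F a ∂ν < ⊤ := by
    set ρ : ℝ := (2 : ℝ) ^ (-(τ - θm / finrank ℚ K)) with hρ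
    have hρ0 : 0 ≤ ρ := Real.rpow_nonneg two_pos.le _
    have hρ1 : ρ < 1 := by
      refine Real.rpow_lt_one_of_one_lt_of_neg (by norm_num) ?_
      rw [neg_neg_iff_pos, sub_pos, div_lt_iff₀ hdR, hτ]
      nlinarith
    have hρ1' : ρ ≤ 1 := hρ1.le
    refine lt_of_le_of_lt (ENNReal.tsum_le_tsum fun m => hshellb θm hθm0 hθmk (-(m + 1 : ℤ))) ?_
    refine lt_of_le_of_lt (ENNReal.tsum_le_tsum fun m => ?_)
      (tsum_mul_ofReal_mul_pow_mul_lt_top hV.ne (hZ θm hθm1).ne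
        (A := 4 ^ τ * M * c ^ (-θm)) (by positivity) hρ0 hρ1)
    refine mul_le_mul' (mul_le_mul' le_rfl (ENNReal.ofReal_le_ofReal ?_)) le_rfl
    refine mul_le_mul_of_nonneg_left ?_ (by positivity)
    have hcast : (((-(m + 1 : ℤ)) : ℤ) : ℝ) * (τ - θm / finrank ℚ K) = ((m + 1 : ℕ) : ℝ) * (-(τ - θm / finrank ℚ K)) := by
      push_cast
      ring
    rw [hcast, mul_comm, Real.rpow_mul two_pos.le, Real.rpow_natCast]
    exact pow_le_pow_of_le_one hρ0 hρ1' (Nat.le_succ m)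
  -- assembly
  calc ∫⁻ a, F a ∂ν = ∫⁻ a in univ, F a ∂ν := (setLIntegral_univ F).symm
    _ ≤ ∫⁻ a in ⋃ j, shell j, F a ∂ν := lintegral_mono_set hcover
    _ ≤ ∑' j : ℤ, ∫⁻ a in shell j, F a ∂ν := lintegral_iUnion_le shell F
    _ = ∑' m : ℕ, ∫⁻ a in shell (m : ℤ), F a ∂ν + ∑' m : ℕ, ∫⁻ a in shell (-(m + 1 : ℤ)), F a ∂ν :=
        tsum_of_nat_of_neg_add_one ENNReal.summable ENNReal.summable
    _ < ⊤ := ENNReal.add_lt_top.2 ⟨hplus, hminus⟩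

/-! ### Linearity and the discharge of the named fact -/

/-! ### Coordinates of `x d` for a positive real diagonal `d` -/

section Diagonal

/-- `(x d)_j = x_j z(b_j)` for `d = diag(z(b₁), …, z(bₙ))`. [folklore] -/
theorem vecMul_posRealDiagonal_apply (x : Fin n → AdeleRing (𝓞 K) K) (b : Fin n → ℝ≥0ˣ) (j : Fin n) :
    (x ᵥ* (posRealDiagonal n K b : Matrix (Fin n) (Fin n) (AdeleRing (𝓞 K) K))) j =
      x j * ((posRealIdele K (b j) : (AdeleRing (𝓞 K) K)ˣ) : AdeleRing (𝓞 K) K) := by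
  rw [coe_posRealDiagonal, Matrix.vecMul_diagonal]

/-- Archimedean coordinates of `x d`: `(x d)_{∞,j} = b_j x_{∞,j}`. [folklore] -/
theorem vecInfinitePart_vecMul_posRealDiagonal (x : Fin n → AdeleRing (𝓞 K) K) (b : Fin n → ℝ≥0ˣ) :
    vecInfinitePart K n (x ᵥ* (posRealDiagonal n K b : Matrix (Fin n) (Fin n) (AdeleRing (𝓞 K) K))) =
      fun j => ((b j : ℝ≥0) : ℝ) • vecInfinitePart K n x j := by
  funext j
  rw [vecInfinitePart_apply, vecMul_posRealDiagonal_apply]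
  change InfiniteAdeleRing.ringEquiv_mixedSpace K ((x j).1 *
    ((posRealIdele K (b j) : (AdeleRing (𝓞 K) K)ˣ) : AdeleRing (𝓞 K) K).1) = _
  rw [map_mul, posRealIdele_fst, ringEquiv_mixedSpace_realToInfiniteAdele, mul_comm,
    ← Algebra.smul_def]
  rfl

/-- Finite coordinates of `x d`: `(x d)_f = x_f`. [folklore] -/
theorem vecFinitePart_vecMul_posRealDiagonal (x : Fin n → AdeleRing (𝓞 K) K) (b : Fin n → ℝ≥0ˣ) :
    vecFinitePart K n (x ᵥ* (posRealDiagonal n K b : Matrix (Fin n) (Fin n) (AdeleRing (𝓞 K) K))) =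
      vecFinitePart K n x := by
  funext j
  rw [vecFinitePart_apply, vecMul_posRealDiagonal_apply]
  change (x j).2 * ((posRealIdele K (b j) : (AdeleRing (𝓞 K) K)ˣ) : AdeleRing (𝓞 K) K).2 = _
  rw [posRealIdele_snd, mul_one]
  rfl

/-- **`‖(x d)_∞‖ ≥ m ‖x_∞‖`** if all `b_j ≥ m`. [folklore] -/
theorem mul_norm_vecInfinitePart_le_of_le {m : ℝ} (hm : 0 < m) {b : Fin n → ℝ≥0ˣ}
    (hb : ∀ j, m ≤ ((b j : ℝ≥0) : ℝ)) (x : Fin n → AdeleRing (𝓞 K) K) :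
    m * ‖vecInfinitePart K n x‖ ≤
      ‖vecInfinitePart K n (x ᵥ* (posRealDiagonal n K b : Matrix (Fin n) (Fin n) (AdeleRing (𝓞 K) K)))‖ := by
  rw [vecInfinitePart_vecMul_posRealDiagonal, mul_comm, ← le_div_iff₀ hm]
  refine (pi_norm_le_iff_of_nonneg (by positivity)).2 fun j => ?_
  rw [le_div_iff₀ hm]
  calc ‖vecInfinitePart K n x j‖ * m ≤ ‖vecInfinitePart K n x j‖ * ((b j : ℝ≥0) : ℝ) :=
        mul_le_mul_of_nonneg_left (hb j) (norm_nonneg _)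
    _ = ‖((b j : ℝ≥0) : ℝ) • vecInfinitePart K n x j‖ := by
        rw [_root_.norm_smul, Real.norm_of_nonneg (NNReal.coe_nonneg _), mul_comm]
    _ ≤ ‖fun j => ((b j : ℝ≥0) : ℝ) • vecInfinitePart K n x j‖ :=
        norm_le_pi_norm (fun j => ((b j : ℝ≥0) : ℝ) • vecInfinitePart K n x j) j

end Diagonal

/-! ### Scaling along the positive real diagonal torus -/

/-- **Scaling along `A_T`.** Let `ν` be a left-invariant measure on `𝔸_Kˣ` and `Φ₀ : 𝔸_Kⁿ → ℂ`
radially monotone: `|Φ₀(y)| ≤ |Φ₀(x)|` whenever `‖x_∞‖ ≤ ‖y_∞‖` and `x_f = y_f`. Then for a positive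
real diagonal `d = diag(b_j)` with `b_j ≥ m > 0`, `τ ≥ 0` and every `x`,
`∫ |Φ₀(a x d)| |a|^τ dν(a) ≤ m^{-[K:ℚ] τ} ∫ |Φ₀(a x)| |a|^τ dν(a)`:
pointwise `|Φ₀(a x d)| ≤ |Φ₀(z(m) a x)|` and `|a|^τ = m^{-[K:ℚ]τ} |z(m) a|^τ`, then substitute
`a ↦ z(m)⁻¹ a`. [folklore] -/
theorem lintegral_vecMul_posRealDiagonal_le [MeasurableSpace (AdeleRing (𝓞 K) K)]
    [BorelSpace (AdeleRing (𝓞 K) K)] (ν : Measure (GaloisRepresentations.ideleGroup K)) [ν.IsMulLeftInvariant]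
    {Φ₀ : (Fin n → AdeleRing (𝓞 K) K) → ℂ}
    (hrad : ∀ x y, ‖vecInfinitePart K n x‖ ≤ ‖vecInfinitePart K n y‖ →
      vecFinitePart K n x = vecFinitePart K n y → ‖Φ₀ y‖ ≤ ‖Φ₀ x‖)
    {m : ℝ≥0ˣ} {b : Fin n → ℝ≥0ˣ} (hb : ∀ j, (m : ℝ≥0) ≤ (b j : ℝ≥0)) (τ : ℝ)
    (x : Fin n → AdeleRing (𝓞 K) K) :
    ∫⁻ a, (‖Φ₀ ((a : AdeleRing (𝓞 K) K) •
        (x ᵥ* (posRealDiagonal n K b : Matrix (Fin n) (Fin n) (AdeleRing (𝓞 K) K))))‖ₑ : ℝ≥0∞) *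
        ENNReal.ofReal ((IdeleClassGroup.ideleNorm K a : ℝ) ^ τ) ∂ν ≤
      ENNReal.ofReal ((((m : ℝ≥0) : ℝ) ^ finrank ℚ K) ^ (-τ)) *
        ∫⁻ a, (‖Φ₀ ((a : AdeleRing (𝓞 K) K) • x)‖ₑ : ℝ≥0∞) *
          ENNReal.ofReal ((IdeleClassGroup.ideleNorm K a : ℝ) ^ τ) ∂ν := by
  haveI := borelSpace_ideleGroup K
  have hm0 : 0 < ((m : ℝ≥0) : ℝ) := NNReal.coe_pos.2 (pos_iff_ne_zero.2 m.ne_zero)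
  have hmd : 0 < ((m : ℝ≥0) : ℝ) ^ finrank ℚ K := pow_pos hm0 _
  set z : GaloisRepresentations.ideleGroup K := posRealIdele K m with hz
  set G : GaloisRepresentations.ideleGroup K → ℝ≥0∞ := fun a =>
    (‖Φ₀ ((a : AdeleRing (𝓞 K) K) • x)‖ₑ : ℝ≥0∞) *
      ENNReal.ofReal ((IdeleClassGroup.ideleNorm K a : ℝ) ^ τ) with hG
  -- pointwise comparison with the translate by `z(m)`
  have hpt : ∀ a : GaloisRepresentations.ideleGroup K,
      (‖Φ₀ ((a : AdeleRing (𝓞 K) K) •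
        (x ᵥ* (posRealDiagonal n K b : Matrix (Fin n) (Fin n) (AdeleRing (𝓞 K) K))))‖ₑ : ℝ≥0∞) *
        ENNReal.ofReal ((IdeleClassGroup.ideleNorm K a : ℝ) ^ τ) ≤
      ENNReal.ofReal ((((m : ℝ≥0) : ℝ) ^ finrank ℚ K) ^ (-τ)) * G (z * a) := by
    intro a
    -- the function values
    have h1 : ‖Φ₀ ((a : AdeleRing (𝓞 K) K) •
        (x ᵥ* (posRealDiagonal n K b : Matrix (Fin n) (Fin n) (AdeleRing (𝓞 K) K))))‖ ≤
        ‖Φ₀ (((z * a : GaloisRepresentations.ideleGroup K) : AdeleRing (𝓞 K) K) • x)‖ := by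
      refine hrad _ _ ?_ ?_
      · rw [hz, vecInfinitePart_posRealIdele_mul_smul, _root_.norm_smul,
          Real.norm_of_nonneg hm0.le, ← Matrix.smul_vecMul, ← vecInfinitePart_smul]
        exact mul_norm_vecInfinitePart_le_of_le K hm0 (fun j => hb j) _
      · rw [hz, vecFinitePart_posRealIdele_mul_smul, ← Matrix.smul_vecMul,
          vecFinitePart_vecMul_posRealDiagonal, vecFinitePart_smul]
    -- the norms
    have h2 : (IdeleClassGroup.ideleNorm K a : ℝ) ^ τ =
        (((m : ℝ≥0) : ℝ) ^ finrank ℚ K) ^ (-τ) * (IdeleClassGroup.ideleNorm K (z * a) : ℝ) ^ τ := by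
      rw [map_mul, hz, ideleNorm_posRealIdele_holds K m, NNReal.coe_mul, NNReal.coe_pow,
        Real.mul_rpow hmd.le (NNReal.coe_nonneg _), ← mul_assoc, Real.rpow_neg hmd.le,
        inv_mul_cancel₀ (Real.rpow_pos_of_pos hmd τ).ne', one_mul]
    calc (‖Φ₀ ((a : AdeleRing (𝓞 K) K) •
          (x ᵥ* (posRealDiagonal n K b : Matrix (Fin n) (Fin n) (AdeleRing (𝓞 K) K))))‖ₑ : ℝ≥0∞) *
          ENNReal.ofReal ((IdeleClassGroup.ideleNorm K a : ℝ) ^ τ)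
        ≤ (‖Φ₀ (((z * a : GaloisRepresentations.ideleGroup K) : AdeleRing (𝓞 K) K) • x)‖ₑ : ℝ≥0∞) *
          ENNReal.ofReal ((IdeleClassGroup.ideleNorm K a : ℝ) ^ τ) := by
            refine mul_le_mul' ?_ le_rfl
            rw [← ofReal_norm, ← ofReal_norm]
            exact ENNReal.ofReal_le_ofReal h1
      _ = ENNReal.ofReal ((((m : ℝ≥0) : ℝ) ^ finrank ℚ K) ^ (-τ)) * G (z * a) := by
            simp only [hG]
            rw [h2, ENNReal.ofReal_mul (Real.rpow_nonneg hmd.le _)]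
            ring
  calc ∫⁻ a, (‖Φ₀ ((a : AdeleRing (𝓞 K) K) •
        (x ᵥ* (posRealDiagonal n K b : Matrix (Fin n) (Fin n) (AdeleRing (𝓞 K) K))))‖ₑ : ℝ≥0∞) *
        ENNReal.ofReal ((IdeleClassGroup.ideleNorm K a : ℝ) ^ τ) ∂ν
      ≤ ∫⁻ a, ENNReal.ofReal ((((m : ℝ≥0) : ℝ) ^ finrank ℚ K) ^ (-τ)) * G (z * a) ∂ν :=
        lintegral_mono fun a => hpt a
    _ = ENNReal.ofReal ((((m : ℝ≥0) : ℝ) ^ finrank ℚ K) ^ (-τ)) * ∫⁻ a, G (z * a) ∂ν :=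
        lintegral_const_mul' _ _ ENNReal.ofReal_ne_top
    _ = ENNReal.ofReal ((((m : ℝ≥0) : ℝ) ^ finrank ℚ K) ^ (-τ)) * ∫⁻ a, G a ∂ν := by
        rw [lintegral_mul_left_eq_self]

/-! ### The radial majorant `Φ₀ = M (1 + ‖x_∞‖)^{-k} 𝟙_C(x_f)` -/

section Radial

/-- `(𝔸_K^∞)ⁿ` is Hausdorff (Mathlib instances on the restricted product). [folklore] -/
theorem t2Space_finiteAdeleVec : T2Space (Fin n → FiniteAdeleRing (𝓞 K) K) := by
  haveI : T2Space (FiniteAdeleRing (𝓞 K) K) := inferInstanceAs <| T2Space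
    (Πʳ w : HeightOneSpectrum (𝓞 K), [w.adicCompletion K, w.adicCompletionIntegers K])
  infer_instance

variable {K}

/-- The norm of the radial majorant. [folklore] -/
theorem norm_radialMajorant {M : ℝ} (hM0 : 0 ≤ M) (k : ℕ) (C : Set (Fin n → FiniteAdeleRing (𝓞 K) K))
    (y : Fin n → AdeleRing (𝓞 K) K) :
    ‖(((M * (1 + ‖vecInfinitePart K n y‖) ^ (-(k : ℝ)) *
        C.indicator (fun _ => (1 : ℝ)) (vecFinitePart K n y) : ℝ) : ℂ))‖ =
      M * (1 + ‖vecInfinitePart K n y‖) ^ (-(k : ℝ)) * C.indicator (fun _ => (1 : ℝ)) (vecFinitePart K n y) := by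
  have h0 : 0 ≤ 1 + ‖vecInfinitePart K n y‖ := add_nonneg zero_le_one (norm_nonneg _)
  rw [Complex.norm_real, Real.norm_of_nonneg]
  exact mul_nonneg (mul_nonneg hM0 (Real.rpow_nonneg h0 _))
    (Set.indicator_nonneg (fun _ _ => zero_le_one) _)

/-- The radial majorant is radially monotone. [folklore] -/
theorem norm_radialMajorant_le_of_le {M : ℝ} (hM0 : 0 ≤ M) (k : ℕ) (C : Set (Fin n → FiniteAdeleRing (𝓞 K) K))
    {x y : Fin n → AdeleRing (𝓞 K) K} (hxy : ‖vecInfinitePart K n x‖ ≤ ‖vecInfinitePart K n y‖)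
    (hf : vecFinitePart K n x = vecFinitePart K n y) :
    ‖(((M * (1 + ‖vecInfinitePart K n y‖) ^ (-(k : ℝ)) *
        C.indicator (fun _ => (1 : ℝ)) (vecFinitePart K n y) : ℝ) : ℂ))‖ ≤
      ‖(((M * (1 + ‖vecInfinitePart K n x‖) ^ (-(k : ℝ)) *
        C.indicator (fun _ => (1 : ℝ)) (vecFinitePart K n x) : ℝ) : ℂ))‖ := by
  rw [norm_radialMajorant hM0, norm_radialMajorant hM0, hf]
  set X : ℝ := ‖vecInfinitePart K n x‖ with hX
  set Y : ℝ := ‖vecInfinitePart K n y‖ with hY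
  have hX0 : 0 ≤ X := norm_nonneg _
  refine mul_le_mul_of_nonneg_right (mul_le_mul_of_nonneg_left ?_ hM0)
    (Set.indicator_nonneg (fun _ _ => zero_le_one) _)
  exact Real.rpow_le_rpow_of_nonpos (by linarith) (by linarith) (neg_nonpos.2 (Nat.cast_nonneg k))

/-- The radial majorant decays to order `k`. [folklore] -/
theorem norm_radialMajorant_le {M : ℝ} (hM0 : 0 ≤ M) (k : ℕ) (C : Set (Fin n → FiniteAdeleRing (𝓞 K) K))
    (y : Fin n → AdeleRing (𝓞 K) K) :
    ‖(((M * (1 + ‖vecInfinitePart K n y‖) ^ (-(k : ℝ)) *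
        C.indicator (fun _ => (1 : ℝ)) (vecFinitePart K n y) : ℝ) : ℂ))‖ ≤
      M * (1 + ‖vecInfinitePart K n y‖) ^ (-(k : ℝ)) := by
  have h0 : 0 ≤ 1 + ‖vecInfinitePart K n y‖ := add_nonneg zero_le_one (norm_nonneg _)
  rw [norm_radialMajorant hM0]
  refine mul_le_of_le_one_right (mul_nonneg hM0 (Real.rpow_nonneg h0 _)) ?_
  refine Set.indicator_apply_le' (fun _ => le_rfl) (fun _ => zero_le_one)

/-- The radial majorant vanishes unless `y_f ∈ C`. [folklore] -/
theorem radialMajorant_eq_zero (M : ℝ) (k : ℕ) {C : Set (Fin n → FiniteAdeleRing (𝓞 K) K)}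
    {y : Fin n → AdeleRing (𝓞 K) K} (hy : vecFinitePart K n y ∉ C) :
    (((M * (1 + ‖vecInfinitePart K n y‖) ^ (-(k : ℝ)) *
        C.indicator (fun _ => (1 : ℝ)) (vecFinitePart K n y) : ℝ) : ℂ)) = 0 := by
  rw [Set.indicator_of_notMem hy, mul_zero, Complex.ofReal_zero]

variable (K)

/-- `a ↦ |Φ₀(a x)|` is measurable on `𝔸_Kˣ` for the radial majorant with closed `C`. [folklore] -/
theorem measurable_enorm_radialMajorant_smul [MeasurableSpace (AdeleRing (𝓞 K) K)]
    [BorelSpace (AdeleRing (𝓞 K) K)] (M : ℝ) (k : ℕ) {C : Set (Fin n → FiniteAdeleRing (𝓞 K) K)}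
    (hC : IsClosed C) (x : Fin n → AdeleRing (𝓞 K) K) :
    Measurable fun a : GaloisRepresentations.ideleGroup K =>
      (‖(((M * (1 + ‖vecInfinitePart K n ((a : AdeleRing (𝓞 K) K) • x)‖) ^ (-(k : ℝ)) *
        C.indicator (fun _ => (1 : ℝ)) (vecFinitePart K n ((a : AdeleRing (𝓞 K) K) • x)) : ℝ) : ℂ))‖ₑ :
          ℝ≥0∞) := by
  haveI := borelSpace_ideleGroup K
  have hsm : Continuous fun a : GaloisRepresentations.ideleGroup K => (a : AdeleRing (𝓞 K) K) • x :=
    Units.continuous_val.smul continuous_const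
  have h1 : Continuous fun a : GaloisRepresentations.ideleGroup K =>
      M * (1 + ‖vecInfinitePart K n ((a : AdeleRing (𝓞 K) K) • x)‖) ^ (-(k : ℝ)) := by
    refine continuous_const.mul (Continuous.rpow_const ?_ fun a => Or.inl ?_)
    · exact continuous_const.add (continuous_norm.comp ((continuous_vecInfinitePart K).comp hsm))
    · exact (add_pos_of_pos_of_nonneg one_pos (norm_nonneg _)).ne'
  have hS : MeasurableSet ((fun a : GaloisRepresentations.ideleGroup K =>
      vecFinitePart K n ((a : AdeleRing (𝓞 K) K) • x)) ⁻¹' C) :=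
    (hC.preimage ((continuous_vecFinitePart K).comp hsm)).measurableSet
  have h2 : Measurable fun a : GaloisRepresentations.ideleGroup K =>
      C.indicator (fun _ => (1 : ℝ)) (vecFinitePart K n ((a : AdeleRing (𝓞 K) K) • x)) := by
    have h : Measurable fun a : GaloisRepresentations.ideleGroup K =>
        ((fun a : GaloisRepresentations.ideleGroup K =>
          vecFinitePart K n ((a : AdeleRing (𝓞 K) K) • x)) ⁻¹' C).indicator (fun _ => (1 : ℝ)) a :=
      measurable_const.indicator hS
    exact h
  exact (Complex.measurable_ofReal.comp (h1.measurable.mul h2)).enorm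

end Radial

/-! ### Domination of right translates by a compact set -/

/-- **Domination of the right translates `Φ(· c)`, `c` in a compact set.** If
`|Φ(y)| ≤ M (1 + ‖y_∞‖)^{-k}` and `Φ(y) = 0` unless `y_f ∈ C_f` (compact), then for a compact
`C₁ ⊆ GL_n(𝔸_K)` there are `M' ≥ 0` and a compact closed `C_f'` with
`|Φ(y c)| ≤ M' (1 + ‖y_∞‖)^{-k} 𝟙_{C_f'}(y_f)` for all `c ∈ C₁`, `y ∈ 𝔸_Kⁿ`
(`‖y_∞‖ ≤ G ‖(y c)_∞‖` with `G = sup_{C₁} ∑ ‖(c⁻¹)_∞‖`, and `y_f = (y c)_f (c⁻¹)_f`). [folklore] -/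
theorem exists_radialMajorant_of_isCompact {Φ : (Fin n → AdeleRing (𝓞 K) K) → ℂ} {k : ℕ} {M : ℝ}
    (hM0 : 0 ≤ M) (hM : ∀ x, ‖Φ x‖ ≤ M * (1 + ‖vecInfinitePart K n x‖) ^ (-(k : ℝ)))
    {Cf : Set (Fin n → FiniteAdeleRing (𝓞 K) K)} (hCfc : IsCompact Cf)
    (hCf : ∀ x, vecFinitePart K n x ∉ Cf → Φ x = 0)
    {C₁ : Set (GL (Fin n) (AdeleRing (𝓞 K) K))} (hC₁ : IsCompact C₁) :
    ∃ (M' : ℝ) (Cf' : Set (Fin n → FiniteAdeleRing (𝓞 K) K)), 0 ≤ M' ∧ IsCompact Cf' ∧ IsClosed Cf' ∧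
      ∀ c ∈ C₁, ∀ y : Fin n → AdeleRing (𝓞 K) K,
        ‖Φ (y ᵥ* (c : Matrix (Fin n) (Fin n) (AdeleRing (𝓞 K) K)))‖ ≤
          ‖(((M' * (1 + ‖vecInfinitePart K n y‖) ^ (-(k : ℝ)) *
            Cf'.indicator (fun _ => (1 : ℝ)) (vecFinitePart K n y) : ℝ) : ℂ))‖ := by
  haveI := t2Space_finiteAdeleVec K (n := n)
  -- the bound `G` for the archimedean entries of `c⁻¹`, `c ∈ C₁`
  set gA : GL (Fin n) (AdeleRing (𝓞 K) K) → ℝ := fun c =>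
    ∑ i, ∑ j, ‖(((c⁻¹ : GL (Fin n) (AdeleRing (𝓞 K) K)) : Matrix (Fin n) (Fin n) (AdeleRing (𝓞 K) K)).map
      fun a => InfiniteAdeleRing.ringEquiv_mixedSpace K a.1) i j‖ with hgA
  have hgAc : Continuous gA := by
    refine continuous_finsetSum _ fun i _ => continuous_finsetSum _ fun j _ => ?_
    refine continuous_norm.comp ?_
    have hmap : Continuous fun c : GL (Fin n) (AdeleRing (𝓞 K) K) =>
        ((c⁻¹ : GL (Fin n) (AdeleRing (𝓞 K) K)) : Matrix (Fin n) (Fin n) (AdeleRing (𝓞 K) K)).map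
          fun a => InfiniteAdeleRing.ringEquiv_mixedSpace K a.1 :=
      Units.continuous_coe_inv.matrix_map ((continuous_ringEquiv_mixedSpace K).comp continuous_fst)
    exact hmap.matrix_elem i j
  obtain ⟨B, hB⟩ := hC₁.exists_bound_of_continuousOn hgAc.continuousOn
  set G : ℝ := max B 1 with hG
  have hG1 : 1 ≤ G := le_max_right _ _
  have hG0 : 0 < G := one_pos.trans_le hG1
  have hgAle : ∀ c ∈ C₁, gA c ≤ G := fun c hc =>
    ((Real.le_norm_self _).trans (hB c hc)).trans (le_max_left _ _)
  -- the compact set of finite parts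
  set F : (Fin n → FiniteAdeleRing (𝓞 K) K) × GL (Fin n) (AdeleRing (𝓞 K) K) →
      (Fin n → FiniteAdeleRing (𝓞 K) K) := fun p =>
    p.1 ᵥ* ((p.2⁻¹ : GL (Fin n) (AdeleRing (𝓞 K) K)) : Matrix (Fin n) (Fin n) (AdeleRing (𝓞 K) K)).map Prod.snd
    with hF
  have hFc : Continuous F :=
    continuous_fst.matrix_vecMul
      ((Units.continuous_coe_inv.comp continuous_snd).matrix_map continuous_snd)
  set Cf' : Set (Fin n → FiniteAdeleRing (𝓞 K) K) := F '' (Cf ×ˢ C₁) with hCf'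
  have hCf'c : IsCompact Cf' := (hCfc.prod hC₁).image hFc
  refine ⟨M * G ^ k, Cf', mul_nonneg hM0 (pow_nonneg hG0.le _), hCf'c, hCf'c.isClosed,
    fun c hc y => ?_⟩
  rw [norm_radialMajorant (mul_nonneg hM0 (pow_nonneg hG0.le _))]
  by_cases hy : vecFinitePart K n y ∈ Cf'
  · rw [Set.indicator_of_mem hy, mul_one]
    -- `‖y_∞‖ ≤ G ‖(y c)_∞‖`
    have hdec : vecInfinitePart K n y =
        vecInfinitePart K n (y ᵥ* (c : Matrix (Fin n) (Fin n) (AdeleRing (𝓞 K) K))) ᵥ*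
          ((c⁻¹ : GL (Fin n) (AdeleRing (𝓞 K) K)) : Matrix (Fin n) (Fin n) (AdeleRing (𝓞 K) K)).map
            (fun a => InfiniteAdeleRing.ringEquiv_mixedSpace K a.1) := by
      rw [← vecInfinitePart_vecMul, Matrix.vecMul_vecMul, ← Matrix.GeneralLinearGroup.coe_mul,
        mul_inv_cancel, Matrix.GeneralLinearGroup.coe_one, Matrix.vecMul_one]
    have hyle : ‖vecInfinitePart K n y‖ ≤
        G * ‖vecInfinitePart K n (y ᵥ* (c : Matrix (Fin n) (Fin n) (AdeleRing (𝓞 K) K)))‖ := by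
      calc ‖vecInfinitePart K n y‖
          ≤ gA c * ‖vecInfinitePart K n (y ᵥ* (c : Matrix (Fin n) (Fin n) (AdeleRing (𝓞 K) K)))‖ := by
            conv_lhs => rw [hdec]
            exact norm_vecMul_le _ _
        _ ≤ G * ‖vecInfinitePart K n (y ᵥ* (c : Matrix (Fin n) (Fin n) (AdeleRing (𝓞 K) K)))‖ :=
            mul_le_mul_of_nonneg_right (hgAle c hc) (norm_nonneg _)
    -- `(1 + ‖(y c)_∞‖)^{-k} ≤ G^k (1 + ‖y_∞‖)^{-k}`
    have hcmp : (1 + ‖vecInfinitePart K n (y ᵥ* (c : Matrix (Fin n) (Fin n) (AdeleRing (𝓞 K) K)))‖) ^ (-(k : ℝ)) ≤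
        G ^ k * (1 + ‖vecInfinitePart K n y‖) ^ (-(k : ℝ)) := by
      set X : ℝ := ‖vecInfinitePart K n y‖ with hX
      set X' : ℝ := ‖vecInfinitePart K n (y ᵥ* (c : Matrix (Fin n) (Fin n) (AdeleRing (𝓞 K) K)))‖ with hX'
      have hX0 : 0 ≤ X := norm_nonneg _
      have hX'0 : 0 ≤ X' := norm_nonneg _
      have h1X : 0 < 1 + X := by linarith
      have hle : (1 + X) / G ≤ 1 + X' := by
        rw [div_le_iff₀ hG0]
        nlinarith
      calc (1 + X') ^ (-(k : ℝ)) ≤ ((1 + X) / G) ^ (-(k : ℝ)) :=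
            Real.rpow_le_rpow_of_nonpos (div_pos h1X hG0) hle (neg_nonpos.2 (Nat.cast_nonneg k))
        _ = G ^ k * (1 + X) ^ (-(k : ℝ)) := by
            rw [Real.div_rpow h1X.le hG0.le, Real.rpow_neg hG0.le, Real.rpow_natCast,
              div_eq_mul_inv, inv_inv, mul_comm]
    calc ‖Φ (y ᵥ* (c : Matrix (Fin n) (Fin n) (AdeleRing (𝓞 K) K)))‖
        ≤ M * (1 + ‖vecInfinitePart K n (y ᵥ* (c : Matrix (Fin n) (Fin n) (AdeleRing (𝓞 K) K)))‖) ^ (-(k : ℝ)) :=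
          hM _
      _ ≤ M * (G ^ k * (1 + ‖vecInfinitePart K n y‖) ^ (-(k : ℝ))) := mul_le_mul_of_nonneg_left hcmp hM0
      _ = M * G ^ k * (1 + ‖vecInfinitePart K n y‖) ^ (-(k : ℝ)) := (mul_assoc _ _ _).symm
  · rw [Set.indicator_of_notMem hy, mul_zero]
    have hzero : Φ (y ᵥ* (c : Matrix (Fin n) (Fin n) (AdeleRing (𝓞 K) K))) = 0 := by
      refine hCf _ fun hmem => hy ?_
      refine ⟨(vecFinitePart K n (y ᵥ* (c : Matrix (Fin n) (Fin n) (AdeleRing (𝓞 K) K))), c), ⟨hmem, hc⟩, ?_⟩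
      simp only [hF]
      rw [← vecFinitePart_vecMul, Matrix.vecMul_vecMul, ← Matrix.GeneralLinearGroup.coe_mul,
        mul_inv_cancel, Matrix.GeneralLinearGroup.coe_one, Matrix.vecMul_one]
    rw [hzero, norm_zero]


/-! ### Polynomial growth of the majorant along `A_T · C₁` -/

/-- **Polynomial growth of the majorant along the positive real diagonal torus (standard `Φ`).**
For a Haar measure `ν` on `𝔸_Kˣ`, a standard Schwartz–Bruhat `Φ`, `σ > 1` and a compact
`C₁ ⊆ GL_n(𝔸_K)` there is `C < ∞` such that for all `c ∈ C₁` and all positive real diagonal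
`d = diag(b_j)` with `b_j ≥ m > 0`:
`∑_p ∫ |Φ(a ξ_p d c)| |a|^{nσ} dν(a) ≤ m^{-n [K:ℚ] σ} · C`
(dominate the translates `Φ(· c)` by one radial majorant `Φ₀`,
`exists_radialMajorant_of_isCompact`; scale, `lintegral_vecMul_posRealDiagonal_le`; and
`C = ∑_p ∫ |Φ₀(a ξ_p)| |a|^{nσ} dν < ∞`, `tsum_lintegral_enorm_smul_lt_top_of_decay`).
(Godement–Jacquet (1972), §11; the moderate growth of Eisenstein series in their domain of
convergence.) [cite: GodementJacquetLNM260, §11] -/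
theorem exists_tsum_lintegral_vecMul_mul_le [MeasurableSpace (AdeleRing (𝓞 K) K)]
    [BorelSpace (AdeleRing (𝓞 K) K)] (ν : Measure (GaloisRepresentations.ideleGroup K)) [ν.IsHaarMeasure]
    {Φ : (Fin n → AdeleRing (𝓞 K) K) → ℂ} (hΦ : IsStandardSchwartzBruhat K n Φ) {σ : ℝ} (hσ : 1 < σ)
    {C₁ : Set (GL (Fin n) (AdeleRing (𝓞 K) K))} (hC₁ : IsCompact C₁) :
    ∃ C : ℝ≥0∞, C ≠ ⊤ ∧ ∀ c ∈ C₁, ∀ (m : ℝ≥0ˣ) (b : Fin n → ℝ≥0ˣ), (∀ j, (m : ℝ≥0) ≤ (b j : ℝ≥0)) →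
      ∑' p : Projectivization K (Fin n → K),
        ∫⁻ a, (‖Φ ((a : AdeleRing (𝓞 K) K) • (ratVec K p.rep ᵥ*
            ((posRealDiagonal n K b * c : GL (Fin n) (AdeleRing (𝓞 K) K)) :
              Matrix (Fin n) (Fin n) (AdeleRing (𝓞 K) K))))‖ₑ : ℝ≥0∞) *
          ENNReal.ofReal ((IdeleClassGroup.ideleNorm K a : ℝ) ^ ((n : ℝ) * σ)) ∂ν ≤
        ENNReal.ofReal ((((m : ℝ≥0) : ℝ) ^ finrank ℚ K) ^ (-((n : ℝ) * σ))) * C := by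
  haveI := borelSpace_ideleGroup K
  -- decay and support of `Φ` to an order `k > n [K:ℚ] σ`
  set k : ℕ := ⌊(n : ℝ) * finrank ℚ K * σ⌋₊ + 1 with hk'
  have hk : (n : ℝ) * finrank ℚ K * σ < k := by
    rw [hk']
    push_cast
    exact Nat.lt_floor_add_one _
  obtain ⟨M, hM0, hM⟩ := hΦ.exists_norm_le_rpow_neg k
  obtain ⟨Cf, hCfc, hCf⟩ := hΦ.exists_isCompact_eq_zero
  obtain ⟨M', Cf', hM'0, hCf'c, hCf'cl, hdom⟩ :=
    exists_radialMajorant_of_isCompact K hM0 hM hCfc hCf hC₁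
  -- the radial majorant `Φ₀`
  set Φ₀ : (Fin n → AdeleRing (𝓞 K) K) → ℂ := fun y =>
    (((M' * (1 + ‖vecInfinitePart K n y‖) ^ (-(k : ℝ)) *
      Cf'.indicator (fun _ => (1 : ℝ)) (vecFinitePart K n y) : ℝ) : ℂ)) with hΦ₀
  have hmeas₀ : ∀ x : Fin n → AdeleRing (𝓞 K) K, Measurable fun a : GaloisRepresentations.ideleGroup K =>
      (‖Φ₀ ((a : AdeleRing (𝓞 K) K) • x)‖ₑ : ℝ≥0∞) :=
    fun x => measurable_enorm_radialMajorant_smul K M' k hCf'cl x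
  have hM₀ : ∀ y, ‖Φ₀ y‖ ≤ M' * (1 + ‖vecInfinitePart K n y‖) ^ (-(k : ℝ)) :=
    fun y => norm_radialMajorant_le hM'0 k Cf' y
  have hCf₀ : ∀ y, vecFinitePart K n y ∉ Cf' → Φ₀ y = 0 := fun y hy => radialMajorant_eq_zero M' k hy
  have hrad₀ : ∀ x y, ‖vecInfinitePart K n x‖ ≤ ‖vecInfinitePart K n y‖ →
      vecFinitePart K n x = vecFinitePart K n y → ‖Φ₀ y‖ ≤ ‖Φ₀ x‖ :=
    fun x y hxy hf => norm_radialMajorant_le_of_le hM'0 k Cf' hxy hf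
  have hfin := tsum_lintegral_enorm_smul_lt_top_of_decay K ν
    (1 : GL (Fin n) (AdeleRing (𝓞 K) K)) hmeas₀ hM'0 hM₀ hCf'c hCf₀ hσ hk
  simp only [Matrix.GeneralLinearGroup.coe_one, Matrix.vecMul_one] at hfin
  refine ⟨_, hfin.ne, fun c hc m b hb => ?_⟩
  calc ∑' p : Projectivization K (Fin n → K),
        ∫⁻ a, (‖Φ ((a : AdeleRing (𝓞 K) K) • (ratVec K p.rep ᵥ*
            ((posRealDiagonal n K b * c : GL (Fin n) (AdeleRing (𝓞 K) K)) :
              Matrix (Fin n) (Fin n) (AdeleRing (𝓞 K) K))))‖ₑ : ℝ≥0∞) *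
          ENNReal.ofReal ((IdeleClassGroup.ideleNorm K a : ℝ) ^ ((n : ℝ) * σ)) ∂ν
      ≤ ∑' p : Projectivization K (Fin n → K),
        ∫⁻ a, (‖Φ₀ ((a : AdeleRing (𝓞 K) K) • (ratVec K p.rep ᵥ*
            (posRealDiagonal n K b : Matrix (Fin n) (Fin n) (AdeleRing (𝓞 K) K))))‖ₑ : ℝ≥0∞) *
          ENNReal.ofReal ((IdeleClassGroup.ideleNorm K a : ℝ) ^ ((n : ℝ) * σ)) ∂ν := by
        refine ENNReal.tsum_le_tsum fun p => lintegral_mono fun a => mul_le_mul' ?_ le_rfl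
        rw [← ofReal_norm, ← ofReal_norm]
        refine ENNReal.ofReal_le_ofReal ?_
        rw [Matrix.GeneralLinearGroup.coe_mul, ← Matrix.vecMul_vecMul, ← Matrix.smul_vecMul]
        exact hdom c hc _
    _ ≤ ∑' p : Projectivization K (Fin n → K),
        ENNReal.ofReal ((((m : ℝ≥0) : ℝ) ^ finrank ℚ K) ^ (-((n : ℝ) * σ))) *
          ∫⁻ a, (‖Φ₀ ((a : AdeleRing (𝓞 K) K) • ratVec K p.rep)‖ₑ : ℝ≥0∞) *
            ENNReal.ofReal ((IdeleClassGroup.ideleNorm K a : ℝ) ^ ((n : ℝ) * σ)) ∂ν :=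
        ENNReal.tsum_le_tsum fun p => lintegral_vecMul_posRealDiagonal_le K ν hrad₀ hb _ _
    _ = ENNReal.ofReal ((((m : ℝ≥0) : ℝ) ^ finrank ℚ K) ^ (-((n : ℝ) * σ))) *
        ∑' p : Projectivization K (Fin n → K),
          ∫⁻ a, (‖Φ₀ ((a : AdeleRing (𝓞 K) K) • ratVec K p.rep)‖ₑ : ℝ≥0∞) *
            ENNReal.ofReal ((IdeleClassGroup.ideleNorm K a : ℝ) ^ ((n : ℝ) * σ)) ∂ν :=
        ENNReal.tsum_mul_left

/-- **Polynomial growth of the majorant along `A_T · C₁` for every `Φ ∈ 𝒮(𝔸_Kⁿ)`** (linearity in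
`Φ`, `Submodule.span_induction`): `Φ` is continuous and for each compact `C₁` there is `C < ∞`
with `∑_p ∫ |Φ(a ξ_p d c)| |a|^{nσ} dν ≤ m^{-n [K:ℚ] σ} C` for all `c ∈ C₁`, `d = diag(b_j)`,
`b_j ≥ m > 0`. [cite: GodementJacquetLNM260, §11] -/
theorem exists_tsum_lintegral_vecMul_mul_le_of_mem [MeasurableSpace (AdeleRing (𝓞 K) K)]
    [BorelSpace (AdeleRing (𝓞 K) K)] (ν : Measure (GaloisRepresentations.ideleGroup K)) [ν.IsHaarMeasure]
    {Φ : (Fin n → AdeleRing (𝓞 K) K) → ℂ} (hΦ : Φ ∈ adelicSchwartzBruhat K n) {σ : ℝ} (hσ : 1 < σ) :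
    Continuous Φ ∧ ∀ C₁ : Set (GL (Fin n) (AdeleRing (𝓞 K) K)), IsCompact C₁ →
      ∃ C : ℝ≥0∞, C ≠ ⊤ ∧ ∀ c ∈ C₁, ∀ (m : ℝ≥0ˣ) (b : Fin n → ℝ≥0ˣ), (∀ j, (m : ℝ≥0) ≤ (b j : ℝ≥0)) →
        ∑' p : Projectivization K (Fin n → K),
          ∫⁻ a, (‖Φ ((a : AdeleRing (𝓞 K) K) • (ratVec K p.rep ᵥ*
              ((posRealDiagonal n K b * c : GL (Fin n) (AdeleRing (𝓞 K) K)) :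
                Matrix (Fin n) (Fin n) (AdeleRing (𝓞 K) K))))‖ₑ : ℝ≥0∞) *
            ENNReal.ofReal ((IdeleClassGroup.ideleNorm K a : ℝ) ^ ((n : ℝ) * σ)) ∂ν ≤
          ENNReal.ofReal ((((m : ℝ≥0) : ℝ) ^ finrank ℚ K) ^ (-((n : ℝ) * σ))) * C := by
  haveI := borelSpace_ideleGroup K
  induction hΦ using Submodule.span_induction with
  | mem Φ hΦ =>
      exact ⟨hΦ.continuous, fun C₁ hC₁ => exists_tsum_lintegral_vecMul_mul_le K ν hΦ hσ hC₁⟩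
  | zero =>
      refine ⟨continuous_const, fun C₁ hC₁ => ⟨0, ENNReal.zero_ne_top, fun c hc m b hb => ?_⟩⟩
      simp
  | add Φ Ψ _ _ hΦ hΨ =>
      refine ⟨hΦ.1.add hΨ.1, fun C₁ hC₁ => ?_⟩
      obtain ⟨CΦ, hCΦ, hΦb⟩ := hΦ.2 C₁ hC₁
      obtain ⟨CΨ, hCΨ, hΨb⟩ := hΨ.2 C₁ hC₁
      refine ⟨CΦ + CΨ, ENNReal.add_ne_top.2 ⟨hCΦ, hCΨ⟩, fun c hc m b hb => ?_⟩
      set g : GL (Fin n) (AdeleRing (𝓞 K) K) := posRealDiagonal n K b * c with hg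
      calc ∑' p : Projectivization K (Fin n → K),
            ∫⁻ a, (‖(Φ + Ψ) ((a : AdeleRing (𝓞 K) K) •
              (ratVec K p.rep ᵥ* (g : Matrix (Fin n) (Fin n) (AdeleRing (𝓞 K) K))))‖ₑ : ℝ≥0∞) *
              ENNReal.ofReal ((IdeleClassGroup.ideleNorm K a : ℝ) ^ ((n : ℝ) * σ)) ∂ν
          ≤ ∑' p : Projectivization K (Fin n → K),
            ((∫⁻ a, (‖Φ ((a : AdeleRing (𝓞 K) K) •
              (ratVec K p.rep ᵥ* (g : Matrix (Fin n) (Fin n) (AdeleRing (𝓞 K) K))))‖ₑ : ℝ≥0∞) *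
              ENNReal.ofReal ((IdeleClassGroup.ideleNorm K a : ℝ) ^ ((n : ℝ) * σ)) ∂ν) +
            ∫⁻ a, (‖Ψ ((a : AdeleRing (𝓞 K) K) •
              (ratVec K p.rep ᵥ* (g : Matrix (Fin n) (Fin n) (AdeleRing (𝓞 K) K))))‖ₑ : ℝ≥0∞) *
              ENNReal.ofReal ((IdeleClassGroup.ideleNorm K a : ℝ) ^ ((n : ℝ) * σ)) ∂ν) := by
            refine ENNReal.tsum_le_tsum fun p => ?_
            rw [← lintegral_add_left (measurable_enorm_apply_smul_mul K hΦ.1 _ _)]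
            refine lintegral_mono fun a => ?_
            rw [← add_mul]
            exact mul_le_mul' (enorm_add_le _ _) le_rfl
        _ = _ := ENNReal.tsum_add
        _ ≤ ENNReal.ofReal ((((m : ℝ≥0) : ℝ) ^ finrank ℚ K) ^ (-((n : ℝ) * σ))) * CΦ +
            ENNReal.ofReal ((((m : ℝ≥0) : ℝ) ^ finrank ℚ K) ^ (-((n : ℝ) * σ))) * CΨ :=
            add_le_add (hΦb c hc m b hb) (hΨb c hc m b hb)
        _ = ENNReal.ofReal ((((m : ℝ≥0) : ℝ) ^ finrank ℚ K) ^ (-((n : ℝ) * σ))) * (CΦ + CΨ) :=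
            (mul_add _ _ _).symm
  | smul r Φ _ hΦ =>
      refine ⟨hΦ.1.const_smul r, fun C₁ hC₁ => ?_⟩
      obtain ⟨CΦ, hCΦ, hΦb⟩ := hΦ.2 C₁ hC₁
      refine ⟨‖r‖ₑ * CΦ, ENNReal.mul_ne_top enorm_ne_top hCΦ, fun c hc m b hb => ?_⟩
      set g : GL (Fin n) (AdeleRing (𝓞 K) K) := posRealDiagonal n K b * c with hg
      calc ∑' p : Projectivization K (Fin n → K),
            ∫⁻ a, (‖(r • Φ) ((a : AdeleRing (𝓞 K) K) •
              (ratVec K p.rep ᵥ* (g : Matrix (Fin n) (Fin n) (AdeleRing (𝓞 K) K))))‖ₑ : ℝ≥0∞) *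
              ENNReal.ofReal ((IdeleClassGroup.ideleNorm K a : ℝ) ^ ((n : ℝ) * σ)) ∂ν
          = ∑' p : Projectivization K (Fin n → K), ‖r‖ₑ *
            ∫⁻ a, (‖Φ ((a : AdeleRing (𝓞 K) K) •
              (ratVec K p.rep ᵥ* (g : Matrix (Fin n) (Fin n) (AdeleRing (𝓞 K) K))))‖ₑ : ℝ≥0∞) *
              ENNReal.ofReal ((IdeleClassGroup.ideleNorm K a : ℝ) ^ ((n : ℝ) * σ)) ∂ν := by
            refine tsum_congr fun p => ?_
            rw [← lintegral_const_mul' _ _ enorm_ne_top]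
            refine lintegral_congr fun a => ?_
            rw [Pi.smul_apply, smul_eq_mul, enorm_mul, mul_assoc]
        _ = ‖r‖ₑ * _ := ENNReal.tsum_mul_left
        _ ≤ ‖r‖ₑ * (ENNReal.ofReal ((((m : ℝ≥0) : ℝ) ^ finrank ℚ K) ^ (-((n : ℝ) * σ))) * CΦ) :=
            mul_le_mul' le_rfl (hΦb c hc m b hb)
        _ = ENNReal.ofReal ((((m : ℝ≥0) : ℝ) ^ finrank ℚ K) ^ (-((n : ℝ) * σ))) * (‖r‖ₑ * CΦ) :=
            mul_left_comm _ _ _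

/-! ### The Eisenstein series is bounded by the majorant -/

/-- **`|E(g, Φ; s)| ≤ |det g|^{re s} · 𝓜(Φ, re s, g)`** for `Φ ∈ 𝒮(𝔸_Kⁿ)` and `re s > 1`: the norm
of the mirabolic Eisenstein series (`mirabolicEisenstein`, a genuine absolutely convergent
series-integral there, `summable_mirabolicEisenstein_holds`) is at most `|det g|^{re s}` times the
majorant `∑_p ∫ |Φ(a ξ_p g)| |a|^{n re s} dν(a)` (finite, `continuous_and_tsum_lintegral_lt_top_of_mem`).
[cite: CogdellAnalyticTheory2004, §2.3] -/
theorem norm_mirabolicEisenstein_le [MeasurableSpace (AdeleRing (𝓞 K) K)] [BorelSpace (AdeleRing (𝓞 K) K)]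
    (ν : Measure (GaloisRepresentations.ideleGroup K)) [ν.IsHaarMeasure]
    {Φ : (Fin n → AdeleRing (𝓞 K) K) → ℂ} (hΦ : Φ ∈ adelicSchwartzBruhat K n) {s : ℂ} (hs : 1 < s.re)
    (g : GL (Fin n) (AdeleRing (𝓞 K) K)) :
    ‖mirabolicEisenstein K ν Φ s g‖ ≤
      (IdeleClassGroup.ideleNorm K (Matrix.GeneralLinearGroup.det g) : ℝ) ^ s.re *
        (∑' p : Projectivization K (Fin n → K),
          ∫⁻ a, (‖Φ ((a : AdeleRing (𝓞 K) K) •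
              (ratVec K p.rep ᵥ* (g : Matrix (Fin n) (Fin n) (AdeleRing (𝓞 K) K))))‖ₑ : ℝ≥0∞) *
            ENNReal.ofReal ((IdeleClassGroup.ideleNorm K a : ℝ) ^ ((n : ℝ) * s.re)) ∂ν).toReal := by
  haveI := borelSpace_ideleGroup K
  obtain ⟨hint, hsum⟩ := summable_mirabolicEisenstein_holds K (n := n) ν Φ hΦ s hs g
  obtain ⟨hcont, hfin⟩ := continuous_and_tsum_lintegral_lt_top_of_mem K ν hΦ
  have htot := hfin s.re hs g
  set T : Projectivization K (Fin n → K) → ℝ≥0∞ := fun p =>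
    ∫⁻ a, (‖Φ ((a : AdeleRing (𝓞 K) K) •
        (ratVec K p.rep ᵥ* (g : Matrix (Fin n) (Fin n) (AdeleRing (𝓞 K) K))))‖ₑ : ℝ≥0∞) *
      ENNReal.ofReal ((IdeleClassGroup.ideleNorm K a : ℝ) ^ ((n : ℝ) * s.re)) ∂ν with hT
  have hTfin : ∀ p, T p ≠ ⊤ := fun p => (lt_of_le_of_lt (ENNReal.le_tsum p) htot).ne
  -- the Bochner integrals of the norms are the `toReal`s of the `T p`
  have hnormint : ∀ p : Projectivization K (Fin n → K),
      ∫ a, ‖eisensteinKernel K Φ s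
        (ratVec K p.rep ᵥ* (g : Matrix (Fin n) (Fin n) (AdeleRing (𝓞 K) K))) a‖ ∂ν = (T p).toReal := by
    intro p
    rw [integral_norm_eq_lintegral_enorm
      ((continuous_eisensteinKernel K hcont s _).aestronglyMeasurable)]
    congr 1
    exact lintegral_congr fun a => enorm_eisensteinKernel K Φ s _ a
  have hdet : 0 < (IdeleClassGroup.ideleNorm K (Matrix.GeneralLinearGroup.det g) : ℝ) :=
    NNReal.coe_pos.2 (pos_iff_ne_zero.2 (ideleNorm_ne_zero _))
  have hle : ∀ p : Projectivization K (Fin n → K),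
      ‖tateVectorIntegral K ν Φ s
        (ratVec K p.rep ᵥ* (g : Matrix (Fin n) (Fin n) (AdeleRing (𝓞 K) K)))‖ ≤ (T p).toReal := fun p =>
    (norm_integral_le_integral_norm _).trans (le_of_eq (hnormint p))
  have hsum' : Summable fun p : Projectivization K (Fin n → K) => (T p).toReal :=
    ENNReal.summable_toReal htot.ne
  rw [mirabolicEisenstein, norm_mul, Complex.norm_cpow_eq_rpow_re_of_pos hdet,
    ENNReal.tsum_toReal_eq hTfin]
  refine mul_le_mul_of_nonneg_left ?_ (Real.rpow_nonneg (NNReal.coe_nonneg _) _)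
  refine (norm_tsum_le_tsum_norm (hsum'.of_nonneg_of_le (fun p => norm_nonneg _) hle)).trans ?_
  exact Summable.tsum_le_tsum hle (hsum'.of_nonneg_of_le (fun p => norm_nonneg _) hle) hsum'

end Literature.NumberTheory.Automorphic
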